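import Literature.Combinatorics.Optimization.ErdosGallaiTheorem
import Literature.Combinatorics.SimpleGraph.HavelHakimi
import HarnessLib

/-!
# The Erdős–Gallai and Havel–Hakimi theorems for simple graphs on `Fin n`
# (Brualdi–Ryser 1991 Thm 6.3.6, Merris 2000 Thm 7.6 — graph-language forms)

Layer `Literature/Combinatorics/SimpleGraph`, namespace
`Literature.Combinatorics.SimpleGraph.ErdosGallaiSimpleGraph` (lane `lit-hodgefound`, prover seat
`lit-hodgefound-p23`, row «A4-17(el)»). The tree's Erdős–Gallai theorem
(`Literature.Combinatorics.Optimization.ErdosGallai.erdosGallai`, Brualdi–Ryser Thm 6.3.6) and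
Havel–Hakimi theorem (`HavelHakimi.havelHakimi`, Merris Thm 7.6) are stated for symmetric
`(0,1)`-matrices with zero trace; this file restates them, through the tree's bridge
`HavelHakimi.graphic_iff_exists_simpleGraph`, for Mathlib's `SimpleGraph (Fin n)` and
`SimpleGraph.degree` — the form "a non-increasing sequence `d₁ ≥ ⋯ ≥ d_n` is the degree sequence
of a simple graph iff …".

## Sources

* [BrualdiRyser1991] R. A. Brualdi, H. J. Ryser, *Combinatorial Matrix Theory* (1991), §6.3
  Thm 6.3.6 (Erdős–Gallai): for monotone `R`, a symmetric `(0,1)`-matrix with zero trace and row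
  sum vector `R` — "the adjacency matrix of a graph with degree sequence `R`" — exists iff `ΣR` is
  even and `Σ_{i≤k} rᵢ ≤ k(k−1) + Σ_{i>k} min(k, rᵢ)` for all `k`.
* [Merris2000] R. Merris, *Graph Theory* (2000), Ch. 7 Thm 7.6 (Havel–Hakimi): "`π` is graphic if
  and only if `π¹ = (π₂ − 1, …, π_{d+1} − 1, π_{d+2}, …)` is graphic", `d = π₁`.

## What is here (theorems only; no definition, no named fact, no axiom, net debt 0)

* **`graphic_iff_erdosGallai`** (`HavelHakimi.Graphic r ↔` parity + Erdős–Gallai inequalities),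
  **`exists_simpleGraph_iff_erdosGallai`** (the same for `∃ G : SimpleGraph (Fin n)` with
  `G.degree = r`), **`exists_simpleGraph_iff_exists_simpleGraph_reduce`** (Havel–Hakimi for
  `SimpleGraph`).
-/

namespace Literature.Combinatorics.SimpleGraph.ErdosGallaiSimpleGraph

open Finset Literature.Combinatorics.SimpleGraph.HavelHakimi

variable {n : ℕ}

/-- **Erdős–Gallai for the labelled matrix form `Graphic`**: a non-increasing `r : Fin n → ℕ` is
graphic iff `Σ r` is even and `Σ_{i<k} rᵢ ≤ k(k−1) + Σ_{i≥k} min(k, rᵢ)` for all `k ≤ n`.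
[cite: BrualdiRyser1991, §6.3 Thm 6.3.6] -/
theorem graphic_iff_erdosGallai (r : Fin n → ℕ) (hr : Antitone r) :
    Graphic r ↔ Even (∑ i, r i) ∧ ∀ k, k ≤ n →
      ∑ i ∈ univ.filter (fun i : Fin n => (i : ℕ) < k), r i ≤
        k * (k - 1) + ∑ i ∈ (univ.filter fun i : Fin n => (i : ℕ) < k)ᶜ, min k (r i) :=
  Literature.Combinatorics.Optimization.ErdosGallai.erdosGallai r hr

/-- **The Erdős–Gallai theorem for simple graphs** (Erdős–Gallai 1960; Brualdi–Ryser 1991,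
Thm 6.3.6): a non-increasing sequence `r₁ ≥ ⋯ ≥ r_n` of natural numbers is the degree sequence of
a simple graph on `n` (labelled) vertices — vertex `i` having degree `rᵢ` — iff `Σ rᵢ` is even and
`Σ_{i≤k} rᵢ ≤ k(k−1) + Σ_{i>k} min(k, rᵢ)` for `1 ≤ k ≤ n` (`0`-indexed below).
[cite: BrualdiRyser1991, §6.3 Thm 6.3.6] -/
theorem exists_simpleGraph_iff_erdosGallai (r : Fin n → ℕ) (hr : Antitone r) :
    (∃ G : _root_.SimpleGraph (Fin n), ∃ _ : DecidableRel G.Adj, ∀ v, G.degree v = r v) ↔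
      Even (∑ i, r i) ∧ ∀ k, k ≤ n →
        ∑ i ∈ univ.filter (fun i : Fin n => (i : ℕ) < k), r i ≤
          k * (k - 1) + ∑ i ∈ (univ.filter fun i : Fin n => (i : ℕ) < k)ᶜ, min k (r i) := by
  rw [← graphic_iff_exists_simpleGraph]
  exact graphic_iff_erdosGallai r hr

/-- **The Havel–Hakimi theorem for simple graphs** (Havel 1955, Hakimi 1962; Merris 2000,
Thm 7.6): for a non-increasing `r` on `n + 1` vertices with `r₀ ≤ n` (and, as in the tree's matrix
form, `r_{j+1} ≥ 1` for the `r₀` vertices `j < r₀` that lose an edge), some simple graph on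
`Fin (n + 1)` has degrees `r` iff some simple graph on `Fin n` has degrees
`HavelHakimi.reduce r` (`r₁ − 1, …, r_{r₀} − 1, r_{r₀+1}, …`). [cite: Merris2000, Ch. 7 Thm 7.6] -/
theorem exists_simpleGraph_iff_exists_simpleGraph_reduce (r : Fin (n + 1) → ℕ) (hr : Antitone r)
    (hΔ : r 0 ≤ n) (hpos : ∀ j : Fin n, (j : ℕ) < r 0 → 1 ≤ r j.succ) :
    (∃ G : _root_.SimpleGraph (Fin (n + 1)), ∃ _ : DecidableRel G.Adj, ∀ v, G.degree v = r v) ↔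
      ∃ G : _root_.SimpleGraph (Fin n), ∃ _ : DecidableRel G.Adj,
        ∀ v, G.degree v = reduce r v := by
  rw [← graphic_iff_exists_simpleGraph, ← graphic_iff_exists_simpleGraph]
  exact havelHakimi r hr hΔ hpos

end Literature.Combinatorics.SimpleGraph.ErdosGallaiSimpleGraph
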